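import Summits.QuantumFields.YangMills.Theorems.BalabanUVNodesN07SymNearRowsDent
import Summits.QuantumFields.YangMills.Theorems.BalabanUVNodesN07PrintWindowDataSmallB
import Summits.QuantumFields.YangMills.Theorems.BalabanUVNodesN07DentDataSmallB
import HarnessLib

/-!
# N07 [B11] (= [15]) Sect. F — MODULE 97′ (plan g93 A3⁵ ∕ №311a (β), chart side (III)-3): **THE DENT-PAIR NEAR ROWS OF `U̿(U^u)♮` UNDER THE φ-b₂ PREMISE, AT THE RECORD** — **PRINT-DATUM EDITION (B)**
# — MODULE 97 (`…N07DbarNearRowsDent`) re-cut: for every level-`m` constraint bond `b` of print's family `D″` with both end blocks in `□_{m+1} ∖ Ω_{m+1}` (a dent pair), the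
# reading is MODULE 93″'s twisted identity at level `m` (`‖ρ̄ − 1‖ ≤ 6ψ` at both ends), the two frame costs are the (L1″) φ-letter at level `m` (✓p744034; `φ_m ≤ φ := 100·(240ℓ²κε′L)²`),
# and the representative's row is MODULE 70∕71's two-block Lemma 1 with the within-block letter in the AVERAGED-CONTOUR axial gauge (✓p746120):
# `‖U̿^{(m)}(U^u)♮(b) − 1‖ ≤ r′ + (ω + ω + ω·ω)(1 + r′)`, `ω := φ + 6ψ + φ·(6ψ)`, `r′ := (d−1)·crad·((1+2C_L)·δ_{m+1}) + 7·t₂(δ_m) + (d+1)(L−1)·(14⌊d(L−1)∕2⌋+1)·((d−1)(L−1)·δ_m)`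

PRINT-DATUM TWIN (FLAG №16 ∕ LOCATE-HSEAM 5d3298b8d191f169; S1c∕C2 of the (E1)∕(iii-b) work plan, director-ym №338∕№339): the parent module (named below) stays landed and true on its own
text; this file is the SAME text with the data row `Sect2.DataSmall7PTop (avOfRecord F N K) s.Ω (suppDom) k δ W` ↦ print's `Sect2.DataSmall7LamTop (avOfRecord F N K) s.Ω (suppDom) k δ W` (§7′;
[15] (7) p. 278 L20–33 on print's ranges) and the fibre row `AgreeOn (genSet s.Ω k) (Ū U) W` ↦ `AgreeOnB (lamBondsSeq s.Ω k) (Ū U) W` ([II] (2.3) «Λ_j = Ω_j^{(j)} ∖ Ω_{j+1}^{(j)} … for the sets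
of sites and the sets of bonds», p. 224; ruling (α) of record: the DIFFERENCE of the bond sets — inward connectors belong to no `Λ_j`), the data readers replaced by their print-datum twins
(`…ChartTopBoxPlaquettesB`, `…PrintWindowDataSmallB`, `…DentDataSmallB`); no other displayed premise is deleted or weakened, every constant is the parent's; proofs = the parent's bytes with the
reader names swapped.  Seat `pub-ymgap-dag-n07-e` g34; `--kind proof --supports stmt-QuantumFields-20541 --as helper` (K0⁷); count-neutral; def-free.
HONEST SCOPE.  Count-neutral helper; nothing of [15]∕[6]∕[3]∕[II] asserted anew; K0⁷ ∕ K1⁹ NOT closed; N07 NOT discharged; counts unmoved (typed 28∕28 · discharged 8∕28); one finite 𝕋⁴ programme at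
fixed ε — the route closes the conditional finite-𝕋⁴ rung `BalabanLadder.UV` ONLY; the YM mass gap (Clay) is NOT proved by any of this; nothing continuum ∕ ℝ⁴ ∕ OS.  No `sorry`, no `def`,
no `instance`, no `notation`.  (The parent's header is not repeated here — see `…N07SymNearRowsDent`; its theorem name carries the suffix `B` here.)

References: [15] (144) p. 300, (147)–(154) pp. 301–302, (160) p. 303; [3] (26)–(27) p. 22, (78)–(81) p. 30, (84)–(92) p. 31, (97) p. 32; [6] Lemma 1 (1.25) p. 79, (1.129)–(1.131)
pp. 98–99; [4] (2.1)–(2.3) p. 224; [I] (0.4), (0.6), (0.11) p. 253.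
-/

set_option autoImplicit false

noncomputable section

open scoped BigOperators Matrix.Norms.L2Operator

namespace Summit.QuantumFields.YangMills.BalabanUVNodes.N07SymNearRowsDentPhiB

open Literature.MathematicalPhysics.QuantumFieldTheory.Balaban1983to89
open Literature.MathematicalPhysics.QuantumFieldTheory.Balaban1983to89.Node00
open Literature.MathematicalPhysics.QuantumFieldTheory.Balaban1983to89.B15DeterminingSets
open Literature.MathematicalPhysics.QuantumFieldTheory.Balaban1983to89.B15DeterminingSetsB
open T4Continuum (T4Family)
open T4AxialGaugeSmallField (castSite)
open T4AxialGaugeRooted (axialGaugeAt)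
open B12GaugeOrbits021 (IsResidual iter_gaugeAct_of_isResidual)
open B15Eq177GaugeInvariance (blockLift)
open B16Sect1Backgrounds (toMS)
open B15Eq112TorusCover (cover)
open B14DomainGeom (Pt Within)
open B7Prop1Local (InBox)
open B8Eq131Cubes (box cube sqLo sqHi tLo tHi ctr crad ctr_mem)
open B5Eq118OneStroke (iterBlockOf iterBlockOf_succ)
open B6SectADomainsV1 (Domains)
open B6SectAOperatorsV1 (BondIdx)
open B10Eq27TorusAxialLog (unitsField toUField gaugeActT val_unitsField)
open B12RegularSpaces111 (gaugeU expI)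
open GaugeField (gaugeAct)
open ExpMeanLog (expMeanLogSU deltaSU)
open FederbushMean (federbushSU deltaFed federbushSU_δ dist1_SU_eq)
open Summit.QuantumFields.YangMills.Theorems.FlatCubeOpsText (Adm22)
open Summit.QuantumFields.YangMills.Theorems.Prop8Chart (emlIterU expCfg)
open Summit.QuantumFields.YangMills.Theorems.Prop8ChartDoubleBar (vframeU dbarIterU)
open Summit.QuantumFields.YangMills.BalabanUVNodes.N07NormalisationDbarFrames (toUT)
open Summit.QuantumFields.YangMills.BalabanUVNodes.N07NormalisationSymOfRecord (symCd)
open Summit.QuantumFields.YangMills.BalabanUVNodes.N07Thm4RecordStructureSym152Phi (NrmSymPhiOfRecord)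
open Summit.QuantumFields.YangMills.BalabanUVNodes.N07SymCurrencyReaderPhi (NrmSymPhiOfRecord.dbar_eq_conj_twist_lamBond)
open Summit.QuantumFields.YangMills.BalabanUVNodes.N07NormalisationWideRows (dist1_gaugeAct_axialGaugeAt_le_of_mem_boxBonds abs_sub_ctr_le_crad Icc_chartBox_subset_Icc_printWindow)
open Summit.QuantumFields.YangMills.BalabanUVNodes.N07ShearSizeTopBox (mem_boxBonds_of_ends_mem_box)
open Summit.QuantumFields.YangMills.BalabanUVNodes.N07PrintWindowDataSmallB (plaqSmallOn_printWindow_iter_of_dataB)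
open Summit.QuantumFields.YangMills.BalabanUVNodes.N09AxialSelectionExists (iter_gaugeAct_blockLift)
open Summit.QuantumFields.YangMills.BalabanUVNodes.N07FarRowsOfTowerLetters (exists_collar_labels_of_lamBond_meet)
open Summit.QuantumFields.YangMills.BalabanUVNodes.N07DbarDictionaryTransfer (emlIterU_unitsField_eq_iter_of_reads₂ emlIterU_eq_iter_apply_of_gaugeAct landau_reads_of_tower)
open Summit.QuantumFields.YangMills.BalabanUVNodes.N07SymCurrencyReader (norm_inv_mul_toUT_sub_one_eq norm_toUT_inv_mul_sub_one_eq norm_conj3_sub_one_le)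
open Summit.QuantumFields.YangMills.BalabanUVNodes.N07DbarFrameTowerOfReads (val_accFrame_mem_unitary)
open Summit.QuantumFields.YangMills.BalabanUVNodes.N07DbarFrameTowerClosedForm (norm_accFrame_sub_shearRIter_le_record)


open B7Prop1Local (InBox)
open B5Eq118OneStroke (iterBlockOf_succ)
open Summit.QuantumFields.YangMills.BalabanUVNodes.N07SymGaugeWithinBlock (dist1_iter_within_le_of_box_sym dist1_iter_crossing_le_of_twoBlocks_sym)
open Summit.QuantumFields.YangMills.BalabanUVNodes.N07DentDataSmallB (plaqSmallOn_dentPair_iter_of_dataB plaqSmallOn_dentBlock_iter_of_dataB)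
open Summit.QuantumFields.YangMills.BalabanUVNodes.N07ChartTopBoxDataSmall (two_mul_L_lt_sitesPerDir)
open Summit.QuantumFields.YangMills.BalabanUVNodes.N07DataDownTheTowerBlowDown (dist1_plaqHol_iter_gaugeAct)
open Summit.QuantumFields.YangMills.BalabanUVNodes.N07NearRowsAtRecordWideClass (not_mem_genSet_of_embIter_not_mem Icc_collar_of_inBox Icc_collar_add_e_of_inBox)
open Summit.QuantumFields.YangMills.BalabanUVNodes.N07RecordDomainsAdm22 (blockSat_seqOfRecord)
open Summit.QuantumFields.YangMills.BalabanUVNodes.N07CubeTowerInsideRecordBelowTop (cubeDomains_Om_subset_meet_Om)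
open Summit.QuantumFields.YangMills.BalabanUVNodes.N07NormalisationSymOfRecord (symTower_gaugeAct_blockLift)
open B7Prop1Explicit (e e_apply)
open T4AxialGaugeSmallField (castSite_add_e boxBonds boxPlaqs)

section Record

variable (F : T4Family) (N : ℕ) [NeZero N]

set_option maxHeartbeats 800000 in
/-- ★★★ **THE DENT-PAIR NEAR ROWS OF `U̿^{(m)}(U^u)♮` UNDER THE φ-b₂ PREMISE, AT THE RECORD** (statement in the header): for every level-`m` constraint bond `b` of print's family `D″`
at a meeting, print-margin-clean datum `(m+1, idx)` with both end blocks in `□_{m+1} ∖ Ω_{m+1}`, `‖U̿^{(m)}(U^u)♮(b) − 1‖ ≤ r′ + (ω + ω + ω·ω)·(1 + r′)`.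
[cite: Balaban1985Variational, (150)–(154) pp.301–302, (160) p.303; Balaban1985Averaging, (78)–(81) p.30, (84)–(92) p.31, (97) p.32; Balaban1985RegularSpaces, Lemma 1 (1.25) p.79, (1.129)–(1.131) pp.98–99; Balaban1984PropagatorsII, (2.1)–(2.3) p.224; Balaban1987RG1, (0.6), (0.11) p.253] -/
theorem norm_dbar_sub_one_dent_le_symPhiB {ν : Stage7Numerics} {M : ℕ} {g : ℕ → ℝ} {K k : ℕ} (s : SeqOfRecord F ν M g K k)
    (hsep : Sect2.SeqSeparated ν.M₁ s) (hkK : k ≤ (F.P K).m + (F.P K).K)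
    (hgrid : ∀ j : ℕ, 1 ≤ j → j ≤ k → dCubeSide (F.P K).L M (RkOfRecord (F.P K).L ν.r (g j)) j ∣ (F.P K).sitesPerDir 0)
    {Mc ρ : ℕ} (hMc : 1 ≤ Mc) (hρ : 1 ≤ ρ) (hLρ : (F.P K).L ≤ ρ) (hfloor : (11 * (F.P K).d + 4 * ρ + Mc) * (F.P K).L + 3 ≤ ν.M₁)
    {δ : ℕ → ℝ} {a₁ : ℝ} (hδ : ∀ n, n ≤ k → 0 < δ n ∧ δ n ≤ a₁) (hcompδ : ∀ n, n < k → δ n ≤ 2 * δ (n + 1))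
    (hguard : (((((F.P K).d + 2) * (F.P K).L : ℕ) : ℝ) ^ 2 / 4) * ((4 * (((((F.P K).d - 1 : ℕ) : ℝ)) * ((2 * (F.P K).L - 1 : ℕ) : ℝ)) + 1) * a₁) < deltaSU (Fin N))
    (hguardF : 2 * ((((F.P K).d * (((F.P K).L - 1) / 2) : ℕ) : ℝ) * (((((F.P K).d - 1 : ℕ) : ℝ) * (((F.P K).L - 1 : ℕ) : ℝ)) * a₁)) < (federbushSU (n := Fin N)).δ)
    (W : MSField (F.P K) (SU N)) (h7 : Sect2.DataSmall7LamTop (avOfRecord F N K) s.Ω (suppDomOfRecord F ν K s.Ω) k δ W)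
    (U : GaugeField (F.P K) 0 (SU N)) (hfib : AgreeOnB (lamBondsSeq s.Ω k) (avgFamily (avOfRecord F N K) U) W)
    {m : ℕ} (hjk : m + 1 ≤ k) (hjK : m + 1 + 1 ≤ (F.P K).m + (F.P K).K) (idx : Pt (F.P K).d)
    (hmeet : ∃ x ∈ box (F.P K).L (cornerP (F.P K) Mc ρ idx) (sideP (F.P K) Mc ρ) (m + 1), ∃ y : Pt (F.P K).d, cover (F.P K) y ∈ s.Ω (m + 1) ∧ Within ((3 : ℕ) : ℤ) x y)
    (hclean : m + 1 = k ∨ ∀ z ∈ box (F.P K).L (cornerP (F.P K) Mc ρ idx - ((2 * ρ : ℕ) : Pt (F.P K).d)) (sideP (F.P K) Mc ρ + 2 * (2 * ρ)) (m + 1),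
      cover (F.P K) z ∉ s.Ω (m + 1 + 1))
    {n₀ : ℕ} (hn : ∀ κ, (tHi (cornerP (F.P K) Mc ρ idx) (sideP (F.P K) Mc ρ) ρ) κ ≤ (tLo (cornerP (F.P K) Mc ρ idx) ρ) κ + n₀) (hnN : n₀ + 1 < (F.P K).sitesPerDir (m + 1))
    -- the Landau copy `(u, A)` at the datum: the S3 door's rows (T1)∕(T2) and the numeric budgets of the dictionary and of the φ-letter
    (u : GaugeTransf (F.P K) 0 (SU N)) (A : PBond (F.P K) 0 → MatA N) {κ ε' : ℝ} (hκ : 0 ≤ κ) (hε' : 0 ≤ ε')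
    (hT1 : ∀ b ∈ (Sect2.regionOfSet (F.P K) (cover (F.P K) '' cube (F.P K).L (cornerP (F.P K) Mc ρ idx) (sideP (F.P K) Mc ρ) ρ (m + 1) 0)).bonds,
      gaugeU (fun x => ιSU N (u x)) (fun b' => ιSU N (U b')) b = expI ((F.P K).eta (m + 1)) (A b))
    (hT2 : ∀ j', j' ≤ m + 1 → ∀ b ∈ (Sect2.regionOfSet (F.P K) (cover (F.P K) '' cube (F.P K).L (cornerP (F.P K) Mc ρ idx) (sideP (F.P K) Mc ρ) ρ (m + 1) j')).bonds,
      ‖A b‖ < κ * ε' * ((F.P K).L : ℝ) ^ (m + 1 - j'))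
    (hgd : 60 * ((((F.P K).d + 2) * (F.P K).L : ℕ) : ℝ) ^ 2 * (κ * ε' * ((F.P K).L : ℝ)) < deltaSU (Fin N))
    (hσF : 5760 * ((((F.P K).d + 2) * (F.P K).L : ℕ) : ℝ) ^ 2 * (κ * ε' * ((F.P K).L : ℝ)) < deltaFed (Fin N))
    (hσS : 2880 * ((((F.P K).d + 2) * (F.P K).L : ℕ) : ℝ) ^ 2 * (κ * ε' * ((F.P K).L : ℝ)) < deltaSU (Fin N))
    (hσ4 : 240 * ((((F.P K).d + 2) * (F.P K).L : ℕ) : ℝ) ^ 2 * (κ * ε' * ((F.P K).L : ℝ)) ≤ 1 / 10000)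
    -- the normalisation of record up to `ψ` (print's own family `D″`) and the (2.2) collar of `D″`
    (hk : m + 1 ≤ (F.P K).m + (F.P K).K) {ψ : ℝ} (hψ0 : 0 ≤ ψ) (hψ : ψ ≤ 1 / 32) (hN : NrmSymPhiOfRecord F N Mc ρ ψ ν M g K k s U (m + 1) idx u A) {R Mb : ℕ}
    (hAdm : Adm22 (domainsMeet (cubeDomains (F.P K) (cornerP (F.P K) Mc ρ idx) (sideP (F.P K) Mc ρ) ρ (m + 1) hk) (domainsOfSeq s.Ω (m + 1) hk)) R Mb)
    (hRM : 2 * (F.P K).L ≤ R * Mb + 1)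
    -- ANY family of accumulated double-bar frames of the Landau copy ([3] (97))
    (V : (i : ℕ) → Site (F.P K) i → (Matrix (Fin N) (Fin N) ℂ)ˣ) (hV0 : ∀ x, V 0 x = 1)
    (hVs : ∀ (i : ℕ) (y : Site (F.P K) (i + 1)), V (i + 1) y = V i (emb y) * vframeU (dbarIterU i (unitsField (toUField (gaugeAct u U)))) y)
    -- the dent-pair bond of `D″`: level `m`, both end blocks in the top cube and off `Ω_{m+1}`
    (b : PBond (F.P K) m)
    (hb : (domainsMeet (cubeDomains (F.P K) (cornerP (F.P K) Mc ρ idx) (sideP (F.P K) Mc ρ) ρ (m + 1) hk) (domainsOfSeq s.Ω (m + 1) hk)).LamBond m b)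
    (hs : blockOf b.src ∈ (cubeDomains (F.P K) (cornerP (F.P K) Mc ρ idx) (sideP (F.P K) Mc ρ) ρ (m + 1) hk).Om (m + 1))
    (hns : blockOf b.src ∉ (domainsOfSeq s.Ω (m + 1) hk).Om (m + 1)) (hnt : blockOf b.tgt ∉ (domainsOfSeq s.Ω (m + 1) hk).Om (m + 1)) :
    ‖((dbarIterU m (unitsField (toUField (gaugeAct u U))) b : (MatA N)ˣ) : MatA N) - 1‖ ≤
      ((((F.P K).d - 1 : ℕ) : ℝ) * (crad (sideP (F.P K) Mc ρ) ρ : ℕ) *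
          ((1 + 2 * ((((F.P K).L : ℝ) ^ 2 + 6 * ((((F.P K).d + 2) * (F.P K).L : ℕ) : ℝ) ^ 2) * (4 * (((((F.P K).d - 1 : ℕ) : ℝ)) * ((2 * (F.P K).L - 1 : ℕ) : ℝ)) + 1))) * δ (m + 1)) +
        7 * ((((((F.P K).d + 2) * (F.P K).L : ℕ) : ℝ) ^ 2 / 4) * ((4 * (((((F.P K).d - 1 : ℕ) : ℝ)) * ((2 * (F.P K).L - 1 : ℕ) : ℝ)) + 1) * δ m)) +
        ((((F.P K).d + 1) * ((F.P K).L - 1) : ℕ) : ℝ) *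
          (((14 * ((F.P K).d * (((F.P K).L - 1) / 2)) + 1 : ℕ) : ℝ) * (((((F.P K).d - 1 : ℕ) : ℝ) * (((F.P K).L - 1 : ℕ) : ℝ)) * δ m))) +
        ((100 * (240 * ((((F.P K).d + 2) * (F.P K).L : ℕ) : ℝ) ^ 2 * (κ * ε' * ((F.P K).L : ℝ))) ^ 2 + 6 * ψ + 100 * (240 * ((((F.P K).d + 2) * (F.P K).L : ℕ) : ℝ) ^ 2 * (κ * ε' * ((F.P K).L : ℝ))) ^ 2 * (6 * ψ)) +
            (100 * (240 * ((((F.P K).d + 2) * (F.P K).L : ℕ) : ℝ) ^ 2 * (κ * ε' * ((F.P K).L : ℝ))) ^ 2 + 6 * ψ + 100 * (240 * ((((F.P K).d + 2) * (F.P K).L : ℕ) : ℝ) ^ 2 * (κ * ε' * ((F.P K).L : ℝ))) ^ 2 * (6 * ψ)) +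
            (100 * (240 * ((((F.P K).d + 2) * (F.P K).L : ℕ) : ℝ) ^ 2 * (κ * ε' * ((F.P K).L : ℝ))) ^ 2 + 6 * ψ + 100 * (240 * ((((F.P K).d + 2) * (F.P K).L : ℕ) : ℝ) ^ 2 * (κ * ε' * ((F.P K).L : ℝ))) ^ 2 * (6 * ψ)) *
              (100 * (240 * ((((F.P K).d + 2) * (F.P K).L : ℕ) : ℝ) ^ 2 * (κ * ε' * ((F.P K).L : ℝ))) ^ 2 + 6 * ψ + 100 * (240 * ((((F.P K).d + 2) * (F.P K).L : ℕ) : ℝ) ^ 2 * (κ * ε' * ((F.P K).L : ℝ))) ^ 2 * (6 * ψ))) *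
          (1 + ((((F.P K).d - 1 : ℕ) : ℝ) * (crad (sideP (F.P K) Mc ρ) ρ : ℕ) *
          ((1 + 2 * ((((F.P K).L : ℝ) ^ 2 + 6 * ((((F.P K).d + 2) * (F.P K).L : ℕ) : ℝ) ^ 2) * (4 * (((((F.P K).d - 1 : ℕ) : ℝ)) * ((2 * (F.P K).L - 1 : ℕ) : ℝ)) + 1))) * δ (m + 1)) +
        7 * ((((((F.P K).d + 2) * (F.P K).L : ℕ) : ℝ) ^ 2 / 4) * ((4 * (((((F.P K).d - 1 : ℕ) : ℝ)) * ((2 * (F.P K).L - 1 : ℕ) : ℝ)) + 1) * δ m)) +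
        ((((F.P K).d + 1) * ((F.P K).L - 1) : ℕ) : ℝ) *
          (((14 * ((F.P K).d * (((F.P K).L - 1) / 2)) + 1 : ℕ) : ℝ) * (((((F.P K).d - 1 : ℕ) : ℝ) * (((F.P K).L - 1 : ℕ) : ℝ)) * δ m)))) := by
  have hℓ0 : (0 : ℝ) ≤ ((((F.P K).d + 2) * (F.P K).L : ℕ) : ℝ) := Nat.cast_nonneg _
  have hℓ1 : (1 : ℝ) ≤ ((((F.P K).d + 2) * (F.P K).L : ℕ) : ℝ) := by
    exact_mod_cast Nat.one_le_iff_ne_zero.mpr (Nat.mul_ne_zero (by omega) (by have := (F.P K).hL.2; omega))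
  have hCL0 : (0 : ℝ) ≤ 1 + 2 * ((((F.P K).L : ℝ) ^ 2 + 6 * ((((F.P K).d + 2) * (F.P K).L : ℕ) : ℝ) ^ 2) *
      (4 * (((((F.P K).d - 1 : ℕ) : ℝ)) * ((2 * (F.P K).L - 1 : ℕ) : ℝ)) + 1)) := by positivity
  have hδj : 0 < δ (m + 1) := (hδ (m + 1) hjk).1
  have hδm : 0 < δ m := (hδ m (by omega)).1
  have hδma : δ m ≤ a₁ := (hδ m (by omega)).2
  obtain ⟨kc, hkc⟩ : ∃ kc : ℝ, kc = (((14 * ((F.P K).d * (((F.P K).L - 1) / 2)) + 1 : ℕ) : ℝ)) := ⟨_, rfl⟩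
  rw [← hkc]
  have hsA0 : 0 ≤ κ * ε' * ((F.P K).L : ℝ) := by positivity
  have hX0 : (0 : ℝ) ≤ (((F.P K).d - 1 : ℕ) : ℝ) * (crad (sideP (F.P K) Mc ρ) ρ : ℕ) := by positivity
  have ht20 : (0 : ℝ) ≤ 7 * ((((((F.P K).d + 2) * (F.P K).L : ℕ) : ℝ) ^ 2 / 4) * ((4 * (((((F.P K).d - 1 : ℕ) : ℝ)) * ((2 * (F.P K).L - 1 : ℕ) : ℝ)) + 1) * δ m)) := by
    positivity
  have hkc0 : (0 : ℝ) ≤ kc := by rw [hkc]; exact Nat.cast_nonneg _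
  have hτ0 : (0 : ℝ) ≤ kc * (((((F.P K).d - 1 : ℕ) : ℝ) * (((F.P K).L - 1 : ℕ) : ℝ)) * δ m) := mul_nonneg hkc0 (by positivity)
  have hdL1 : (1 : ℝ) ≤ ((((F.P K).d + 1) * ((F.P K).L - 1) : ℕ) : ℝ) := by
    have hd : 1 ≤ (F.P K).d := (F.P K).hd
    have hL : 2 ≤ (F.P K).L := by have := (F.P K).hL.2; omega
    have : 1 ≤ ((F.P K).d + 1) * ((F.P K).L - 1) := Nat.one_le_iff_ne_zero.mpr (Nat.mul_ne_zero (by omega) (by omega))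
    exact_mod_cast this
  have ht2g : (((((F.P K).d + 2) * (F.P K).L : ℕ) : ℝ) ^ 2 / 4) * ((4 * (((((F.P K).d - 1 : ℕ) : ℝ)) * ((2 * (F.P K).L - 1 : ℕ) : ℝ)) + 1) * δ m) < deltaSU (Fin N) := by
    refine lt_of_le_of_lt ?_ hguard
    gcongr
  have hguardF' : 2 * ((((F.P K).d * (((F.P K).L - 1) / 2) : ℕ) : ℝ) * (((((F.P K).d - 1 : ℕ) : ℝ) * (((F.P K).L - 1 : ℕ) : ℝ)) * δ m)) < (federbushSU (n := Fin N)).δ := by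
    refine lt_of_le_of_lt ?_ hguardF
    gcongr
  obtain ⟨w, hres, hax, hid⟩ := NrmSymPhiOfRecord.dbar_eq_conj_twist_lamBond hψ0 hψ hN hk hAdm hRM V hV0 hVs
  set h : GaugeTransf (F.P K) (m + 1) (SU N) := axialGaugeAt (Averaging.iter (avOfRecord F N K) (m + 1) (gaugeAct w U))
    (tLo (cornerP (F.P K) Mc ρ idx) ρ) (tHi (cornerP (F.P K) Mc ρ idx) (sideP (F.P K) Mc ρ) ρ) (ctr (cornerP (F.P K) Mc ρ idx) (sideP (F.P K) Mc ρ)) with hh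
  set gw : GaugeTransf (F.P K) 0 (SU N) := fun x => blockLift (m + 1) h x * w x with hgw
  set U'' : GaugeField (F.P K) 0 (SU N) := gaugeAct gw U with hU''
  have hU''2 : U'' = gaugeAct (blockLift (m + 1) h) (gaugeAct w U) := by
    rw [hU'', hgw, ← T3UnitLawGaugeInvariance.gaugeAct_gaugeAct]
  have hresid : Averaging.iter (avOfRecord F N K) (m + 1) (gaugeAct w U) = Averaging.iter (avOfRecord F N K) (m + 1) U :=
    iter_gaugeAct_of_isResidual (avOfRecord F N K) hk hres U
  have htower : AxialGauge (symCd F N K m) (Averaging.iter (avOfRecord F N K) m U'') := by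
    rw [hU''2]; exact symTower_gaugeAct_blockLift F N K hk h (gaugeAct w U) hax m (Nat.lt_succ_self m)
  have htop : Averaging.iter (avOfRecord F N K) (m + 1) U'' = gaugeAct h (Averaging.iter (avOfRecord F N K) (m + 1) U) := by
    rw [hU''2, iter_gaugeAct_blockLift (avOfRecord F N K) hk h (gaugeAct w U), hresid]
  have hplaq : ∀ q : Plaq (F.P K) m, dist1 (GaugeField.plaqHol (Averaging.iter (avOfRecord F N K) m U'') q) =
      dist1 (GaugeField.plaqHol (Averaging.iter (avOfRecord F N K) m U) q) :=
    fun q => dist1_plaqHol_iter_gaugeAct (F := F) (N := N) (K := K) (by omega : m ≤ (F.P K).m + (F.P K).K) gw U q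
  obtain ⟨t, htbox, htb⟩ := (mem_cubeDomains_Om_iff (by omega) le_rfl _).1 hs
  have hsrc : blockOf b.src = (castSite t : Site (F.P K) (m + 1)) := htb.symm
  have htI : t ∈ Set.Icc (sqLo (F.P K).L (cornerP (F.P K) Mc ρ idx) ρ (m + 1) (m + 1) - 1) (sqHi (F.P K).L (cornerP (F.P K) Mc ρ idx) (sideP (F.P K) Mc ρ) ρ (m + 1) (m + 1) + 1) := Icc_collar_of_inBox htbox
  have htμI : t + e b.dir ∈ Set.Icc (sqLo (F.P K).L (cornerP (F.P K) Mc ρ idx) ρ (m + 1) (m + 1) - 1) (sqHi (F.P K).L (cornerP (F.P K) Mc ρ idx) (sideP (F.P K) Mc ρ) ρ (m + 1) (m + 1) + 1) := Icc_collar_add_e_of_inBox htbox b.dir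
  have hIb : ∀ {z : Pt (F.P K).d}, z ∈ Set.Icc (sqLo (F.P K).L (cornerP (F.P K) Mc ρ idx) ρ (m + 1) (m + 1) - 1)
      (sqHi (F.P K).L (cornerP (F.P K) Mc ρ idx) (sideP (F.P K) Mc ρ) ρ (m + 1) (m + 1) + 1) →
      InBox (sqLo (F.P K).L (cornerP (F.P K) Mc ρ idx) ρ (m + 1) (m + 1) - 1) (sqHi (F.P K).L (cornerP (F.P K) Mc ρ idx) (sideP (F.P K) Mc ρ) ρ (m + 1) (m + 1) + 1) z :=
    fun hz i => ⟨hz.1 i, hz.2 i⟩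
  have htgt2 : ∃ t₂ : Pt (F.P K).d, (t₂ = t ∨ t₂ = t + e b.dir) ∧ blockOf b.tgt = (castSite t₂ : Site (F.P K) (m + 1)) := by
    rcases blockOf_shift_or hk b.src b.dir with hsame | hshift
    · exact ⟨t, Or.inl rfl, by rw [PBond.tgt, hsame, hsrc]⟩
    · exact ⟨t + e b.dir, Or.inr rfl, by rw [PBond.tgt, hshift, hsrc, castSite_add_e]⟩
  obtain ⟨t₂, ht₂, htgt⟩ := htgt2
  have ht₂I : t₂ ∈ Set.Icc (sqLo (F.P K).L (cornerP (F.P K) Mc ρ idx) ρ (m + 1) (m + 1) - 1) (sqHi (F.P K).L (cornerP (F.P K) Mc ρ idx) (sideP (F.P K) Mc ρ) ρ (m + 1) (m + 1) + 1) := by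
    rcases ht₂ with rfl | rfl; exacts [htI, htμI]
  have hη0 : 0 ≤ (F.P K).eta (m + 1) := by unfold Params.eta; positivity
  have hpow : (m + 1) - (m + 1 - 1) = 1 := by omega
  have hLη : ((F.P K).L : ℝ) ^ (m + 1) * (F.P K).eta (m + 1) = 1 := B12Eq115BackgroundPair.pow_mul_eta (F.P K) (m + 1)
  have hL1 : (1 : ℝ) ≤ (F.P K).L := by exact_mod_cast (F.P K).L_pos
  have hℓ2 : (1 : ℝ) ≤ ((((F.P K).d + 2) * (F.P K).L : ℕ) : ℝ) ^ 2 := one_le_pow₀ hℓ1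
  have hxℓ : κ * ε' * ((F.P K).L : ℝ) ≤ ((((F.P K).d + 2) * (F.P K).L : ℕ) : ℝ) ^ 2 * (κ * ε' * ((F.P K).L : ℝ)) := by
    have := mul_le_mul_of_nonneg_right hℓ2 hsA0; linarith
  have hxℓℓ : ((((F.P K).d + 2) * (F.P K).L : ℕ) : ℝ) * (κ * ε' * ((F.P K).L : ℝ)) ≤ ((((F.P K).d + 2) * (F.P K).L : ℕ) : ℝ) ^ 2 * (κ * ε' * ((F.P K).L : ℝ)) := by
    have hℓℓ : ((((F.P K).d + 2) * (F.P K).L : ℕ) : ℝ) ≤ ((((F.P K).d + 2) * (F.P K).L : ℕ) : ℝ) ^ 2 := by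
      rw [sq]; exact le_mul_of_one_le_left hℓ0 hℓ1
    exact mul_le_mul_of_nonneg_right hℓℓ hsA0
  have hηsA : (F.P K).eta (m + 1) * (κ * ε' * ((F.P K).L : ℝ)) ≤ 1 := by
    have hη1 : (F.P K).eta (m + 1) ≤ 1 := by unfold Params.eta; exact pow_le_one₀ (by positivity) (inv_le_one_of_one_le₀ (by exact_mod_cast (F.P K).L_pos))
    have h1 : κ * ε' * ((F.P K).L : ℝ) ≤ 1 := by linarith [hxℓ, hσ4]
    calc (F.P K).eta (m + 1) * (κ * ε' * ((F.P K).L : ℝ)) ≤ 1 * (κ * ε' * ((F.P K).L : ℝ)) := mul_le_mul_of_nonneg_right hη1 hsA0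
      _ ≤ 1 := by linarith
  have hreads : ∀ b₀ : PBond (F.P K) 0, (iterBlockOf m b₀.src = b.src ∨ iterBlockOf m b₀.src = b.tgt) →
      (iterBlockOf m b₀.tgt = b.src ∨ iterBlockOf m b₀.tgt = b.tgt) →
      ‖((unitsField (toUField (gaugeAct u U)) b₀ : (MatA N)ˣ) : MatA N) - 1‖ ≤ 2 * ((F.P K).eta (m + 1) * (κ * ε' * ((F.P K).L : ℝ))) := by
    intro b₀ hbs hbt
    have hup : ∀ x : Site (F.P K) 0, (iterBlockOf m x = b.src ∨ iterBlockOf m x = b.tgt) →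
        (iterBlockOf (m + 1) x = coverAt (F.P K) (m + 1) t ∨ iterBlockOf (m + 1) x = coverAt (F.P K) (m + 1) t₂) := by
      intro x hx; rw [iterBlockOf_succ]
      rcases hx with h1 | h1
      · left; rw [h1, hsrc]; rfl
      · right; rw [h1, htgt]; rfl
    obtain ⟨-, h2, h3⟩ := landau_reads_of_tower (k := m + 1) hk hLρ (by omega) le_rfl U u A hη0 hT1 hT2 (hIb htI) (hIb ht₂I) b₀ (hup _ hbs) (hup _ hbt)
    rw [hpow, pow_one] at h3
    exact h3 hηsA
  have hs00 : 0 ≤ 2 * ((F.P K).eta (m + 1) * (κ * ε' * ((F.P K).L : ℝ))) := by positivity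
  have hLm : ((F.P K).L : ℝ) ^ m ≤ ((F.P K).L : ℝ) ^ (m + 1) := pow_le_pow_right₀ hL1 (Nat.le_succ m)
  have hmono : ∀ C : ℝ, 0 ≤ C → C * ((F.P K).L : ℝ) ^ m * (2 * ((F.P K).eta (m + 1) * (κ * ε' * ((F.P K).L : ℝ)))) ≤
      C * ((F.P K).L : ℝ) ^ (m + 1) * (2 * ((F.P K).eta (m + 1) * (κ * ε' * ((F.P K).L : ℝ)))) :=
    fun C hC => mul_le_mul_of_nonneg_right (mul_le_mul_of_nonneg_left hLm hC) hs00
  have hxeq : ((F.P K).L : ℝ) ^ (m + 1) * (2 * ((F.P K).eta (m + 1) * (κ * ε' * ((F.P K).L : ℝ)))) = 2 * (κ * ε' * ((F.P K).L : ℝ)) := by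
    have e : ((F.P K).L : ℝ) ^ (m + 1) * (2 * ((F.P K).eta (m + 1) * (κ * ε' * ((F.P K).L : ℝ)))) =
        2 * (κ * ε' * ((F.P K).L : ℝ)) * (((F.P K).L : ℝ) ^ (m + 1) * (F.P K).eta (m + 1)) := by ring
    rw [e, hLη, mul_one]
  have htopv : ∀ C : ℝ, C * ((F.P K).L : ℝ) ^ (m + 1) * (2 * ((F.P K).eta (m + 1) * (κ * ε' * ((F.P K).L : ℝ)))) = C * (2 * (κ * ε' * ((F.P K).L : ℝ))) := by
    intro C; rw [mul_assoc, hxeq]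
  have hlev : ∀ C : ℝ, 0 ≤ C → C * ((F.P K).L : ℝ) ^ m * (2 * ((F.P K).eta (m + 1) * (κ * ε' * ((F.P K).L : ℝ)))) ≤ C * (2 * (κ * ε' * ((F.P K).L : ℝ))) := by
    intro C hC; have h1 := hmono C hC; rw [htopv] at h1; exact h1
  have hbud' : 6400 * ((((F.P K).d + 2) * (F.P K).L : ℕ) : ℝ) ^ 2 * ((F.P K).L : ℝ) ^ m * (2 * ((F.P K).eta (m + 1) * (κ * ε' * ((F.P K).L : ℝ)))) ≤ 1 :=
    (hlev _ (by positivity)).trans (by linarith [hσ4])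
  have hbudget' : 8 * 3800 * ((((F.P K).d + 2) * (F.P K).L : ℕ) : ℝ) ^ 2 * ((F.P K).L : ℝ) ^ m * (2 * ((F.P K).eta (m + 1) * (κ * ε' * ((F.P K).L : ℝ)))) ≤ 1 :=
    (hlev _ (by positivity)).trans (by linarith [hσ4])
  have hgd' : 30 * ((((F.P K).d + 2) * (F.P K).L : ℕ) : ℝ) ^ 2 * ((F.P K).L : ℝ) ^ m * (2 * ((F.P K).eta (m + 1) * (κ * ε' * ((F.P K).L : ℝ)))) <
      deltaSU (Fin N) := lt_of_le_of_lt (hlev _ (by positivity)) (by linarith)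
  have hguard8 : 8 * ((((F.P K).d + 2) * (F.P K).L : ℕ) : ℝ) * ((F.P K).L : ℝ) ^ m * (2 * ((F.P K).eta (m + 1) * (κ * ε' * ((F.P K).L : ℝ)))) <
      deltaSU (Fin N) := lt_of_le_of_lt (hlev _ (by positivity)) (by linarith [hxℓℓ, hgd])
  have hσm : 120 * ((((F.P K).d + 2) * (F.P K).L : ℕ) : ℝ) ^ 2 * ((F.P K).L : ℝ) ^ m * (2 * ((F.P K).eta (m + 1) * (κ * ε' * ((F.P K).L : ℝ)))) ≤
      240 * ((((F.P K).d + 2) * (F.P K).L : ℕ) : ℝ) ^ 2 * (κ * ε' * ((F.P K).L : ℝ)) := (hlev _ (by positivity)).trans (le_of_eq (by ring))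
  have hσm0 : 0 ≤ 120 * ((((F.P K).d + 2) * (F.P K).L : ℕ) : ℝ) ^ 2 * ((F.P K).L : ℝ) ^ m * (2 * ((F.P K).eta (m + 1) * (κ * ε' * ((F.P K).L : ℝ)))) := by
    positivity
  have hσF' : 24 * (120 * ((((F.P K).d + 2) * (F.P K).L : ℕ) : ℝ) ^ 2 * ((F.P K).L : ℝ) ^ m * (2 * ((F.P K).eta (m + 1) * (κ * ε' * ((F.P K).L : ℝ))))) <
      (federbushSU (n := Fin N)).δ := by rw [federbushSU_δ]; linarith
  have hσS' : 12 * (120 * ((((F.P K).d + 2) * (F.P K).L : ℕ) : ℝ) ^ 2 * ((F.P K).L : ℝ) ^ m * (2 * ((F.P K).eta (m + 1) * (κ * ε' * ((F.P K).L : ℝ))))) <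
      deltaSU (Fin N) := by linarith
  have hσ4' : 120 * ((((F.P K).d + 2) * (F.P K).L : ℕ) : ℝ) ^ 2 * ((F.P K).L : ℝ) ^ m * (2 * ((F.P K).eta (m + 1) * (κ * ε' * ((F.P K).L : ℝ)))) ≤ 1 / 10000 :=
    hσm.trans hσ4
  have hdict := emlIterU_unitsField_eq_iter_of_reads₂ (by omega : m ≤ (F.P K).m + (F.P K).K) (gaugeAct u U) b hs00 hbud' hgd' hreads
  have hdictb : emlIterU m (unitsField (toUField (gaugeAct gw U))) b = unitsField (toUField (Averaging.iter (avOfRecord F N K) m U'')) b :=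
    emlIterU_eq_iter_apply_of_gaugeAct (avOfRecord F N K) (by omega) U u gw b (hdict m le_rfl b (fun _ hx => Or.inl hx) (fun _ hx => Or.inr hx)).1
  have hNm2 : 2 * (F.P K).L < (F.P K).sitesPerDir m := two_mul_L_lt_sitesPerDir (P := F.P K) (m := m) (by omega)
  have hNm : (F.P K).L < (F.P K).sitesPerDir m := by omega
  obtain ⟨x₀, hx₀, y₀, hy₀, hxy₀⟩ := hmeet
  have hnest : ∀ i : ℕ, 1 ≤ i → i < m + 1 → s.Ω (i + 1) ⊆ s.Ω i := fun i h1 hi => s.chain.Ω_succ_subset_Ω h1 (lt_of_lt_of_le hi hjk)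
  have hsat : ∀ (j' : ℕ) (x x' : Site (F.P K) 0), 1 ≤ j' → j' ≤ m + 1 → iterBlockOf j' x = iterBlockOf j' x' → x ∈ s.Ω j' → x' ∈ s.Ω j' :=
    fun j' x x' h1 hj' => blockSat_seqOfRecord F ν M g K k hkK s hgrid j' x x' h1 (hj'.trans hjk)
  have hdent : (castSite t : Site (F.P K) (m + 1)) ∉ genSet s.Ω k (m + 1) := by
    refine not_mem_genSet_of_embIter_not_mem s.Ω (by omega) hjk fun hmem => hns ?_
    rw [hsrc]
    exact (mem_domainsOfSeq_Om_iff_centre s.Ω hk hnest hsat (by omega) le_rfl _).2 hmem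
  have hdent₂ : (castSite t₂ : Site (F.P K) (m + 1)) ∉ genSet s.Ω k (m + 1) := by
    refine not_mem_genSet_of_embIter_not_mem s.Ω (by omega) hjk fun hmem => hnt ?_
    rw [htgt]
    exact (mem_domainsOfSeq_Om_iff_centre s.Ω hk hnest hsat (by omega) le_rfl _).2 hmem
  have hrow : dist1 (Averaging.iter (avOfRecord F N K) m U'' b) ≤ ((((F.P K).d - 1 : ℕ) : ℝ) * (crad (sideP (F.P K) Mc ρ) ρ : ℕ) *
          ((1 + 2 * ((((F.P K).L : ℝ) ^ 2 + 6 * ((((F.P K).d + 2) * (F.P K).L : ℕ) : ℝ) ^ 2) * (4 * (((((F.P K).d - 1 : ℕ) : ℝ)) * ((2 * (F.P K).L - 1 : ℕ) : ℝ)) + 1))) * δ (m + 1)) +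
        7 * ((((((F.P K).d + 2) * (F.P K).L : ℕ) : ℝ) ^ 2 / 4) * ((4 * (((((F.P K).d - 1 : ℕ) : ℝ)) * ((2 * (F.P K).L - 1 : ℕ) : ℝ)) + 1) * δ m)) +
        ((((F.P K).d + 1) * ((F.P K).L - 1) : ℕ) : ℝ) *
          (kc * (((((F.P K).d - 1 : ℕ) : ℝ) * (((F.P K).L - 1 : ℕ) : ℝ)) * δ m))) := by
    rcases ht₂ with ht₂e | ht₂e
    · -- both ends in `B(castSite t)`: 81's one-block letter and the sym within row
      rw [ht₂e] at htgt
      have hA := plaqSmallOn_dentBlock_iter_of_dataB F N s hsep hkK hgrid hMc hρ hfloor W h7 U hfib hjk hk idx ⟨x₀, hx₀, y₀, hy₀, hxy₀⟩ hclean _ htI hdent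
      have hW : PlaqSmallOn (boxPlaqs (fun i => ((F.P K).L : ℤ) * t i) (fun i => ((F.P K).L : ℤ) * t i + (((F.P K).L : ℤ) - 1))) (δ m)
          (Averaging.iter (avOfRecord F N K) m U'') := by
        intro q hq; rw [hplaq q]; exact hA q hq
      have h := dist1_iter_within_le_of_box_sym (F := F) (N := N) (by omega) U'' htower hδm.le hNm hguardF' t hW b hsrc htgt
      rw [← hkc] at h
      refine h.trans ?_
      have h1 : kc * (((((F.P K).d - 1 : ℕ) : ℝ) * (((F.P K).L - 1 : ℕ) : ℝ)) * δ m) ≤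
          ((((F.P K).d + 1) * ((F.P K).L - 1) : ℕ) : ℝ) *
            (kc * (((((F.P K).d - 1 : ℕ) : ℝ) * (((F.P K).L - 1 : ℕ) : ℝ)) * δ m)) :=
        le_mul_of_one_le_left hτ0 hdL1
      have h2 : (0 : ℝ) ≤ (((F.P K).d - 1 : ℕ) : ℝ) * (crad (sideP (F.P K) Mc ρ) ρ : ℕ) *
          ((1 + 2 * ((((F.P K).L : ℝ) ^ 2 + 6 * ((((F.P K).d + 2) * (F.P K).L : ℕ) : ℝ) ^ 2) * (4 * (((((F.P K).d - 1 : ℕ) : ℝ)) * ((2 * (F.P K).L - 1 : ℕ) : ℝ)) + 1))) *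
            δ (m + 1)) := mul_nonneg hX0 (mul_nonneg hCL0 hδj.le)
      linarith only [h1, h2, ht20]
    · -- crossing into `B(castSite (t + e_μ))`: 72's two-block letter, the parent's letter from the rooted top gauge (62″ §1), the sym crossing row
      rw [ht₂e] at htgt hdent₂
      have hA := plaqSmallOn_dentPair_iter_of_dataB F N s hsep hkK hgrid hMc hρ hfloor W h7 U hfib hjk hk idx ⟨x₀, hx₀, y₀, hy₀, hxy₀⟩ hclean t b.dir htI htμI
        hdent hdent₂
      have hW : PlaqSmallOn (boxPlaqs (fun i => ((F.P K).L : ℤ) * t i) (fun i => ((F.P K).L : ℤ) * (t + e b.dir) i + (((F.P K).L : ℤ) - 1))) (δ m)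
          (Averaging.iter (avOfRecord F N K) m U'') := by
        intro q hq; rw [hplaq q]; exact hA q hq
      have hV := plaqSmallOn_printWindow_iter_of_dataB F N s hsep hkK hgrid hMc hρ hfloor hδ hcompδ hguard W h7 U hfib (by omega : 1 ≤ m + 1) hjk hjK idx
        ⟨x₀, hx₀, y₀, hy₀, hxy₀⟩ hclean
      have hS1 : 1 ≤ sideP (F.P K) Mc ρ := by have := le_sideP (P := F.P K) Mc hρ; omega
      obtain ⟨hr1, hr2, -⟩ := ctr_mem (a := cornerP (F.P K) Mc ρ idx) (ρ := ρ) hS1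
      have hNwrap' : ∀ κ', (tHi (cornerP (F.P K) Mc ρ idx) (sideP (F.P K) Mc ρ) ρ) κ' - (tLo (cornerP (F.P K) Mc ρ idx) ρ) κ' < (F.P K).sitesPerDir (m + 1) :=
        fun κ' => by have := hn κ'; omega
      have hIcc := Icc_chartBox_subset_Icc_printWindow (F.P K).L (cornerP (F.P K) Mc ρ idx) (sideP (F.P K) Mc ρ) hρ (m + 1)
      have hpar : (⟨castSite t, b.dir⟩ : PBond (F.P K) (m + 1)) ∈
          boxBonds (tLo (cornerP (F.P K) Mc ρ idx) ρ) (tHi (cornerP (F.P K) Mc ρ idx) (sideP (F.P K) Mc ρ) ρ) :=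
        ⟨t, (hIcc htI).1, (hIcc htμI).2, rfl⟩
      have hα : dist1 (Averaging.iter (avOfRecord F N K) (m + 1) U'' ⟨castSite t, b.dir⟩) ≤
          (((F.P K).d - 1 : ℕ) : ℝ) * (crad (sideP (F.P K) Mc ρ) ρ : ℕ) *
            ((1 + 2 * ((((F.P K).L : ℝ) ^ 2 + 6 * ((((F.P K).d + 2) * (F.P K).L : ℕ) : ℝ) ^ 2) * (4 * (((((F.P K).d - 1 : ℕ) : ℝ)) * ((2 * (F.P K).L - 1 : ℕ) : ℝ)) + 1))) *
              δ (m + 1)) := by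
        rw [htop, hh, hresid]
        exact dist1_gaugeAct_axialGaugeAt_le_of_mem_boxBonds (Averaging.iter (avOfRecord F N K) (m + 1) U) subset_rfl hV (mul_nonneg hCL0 hδj.le) hNwrap' hr1 hr2
          (fun x hx hx' κ' => abs_sub_ctr_le_crad hS1 x hx hx' κ') hpar
      have hcr := dist1_iter_crossing_le_of_twoBlocks_sym (F := F) (N := N) hk U'' htower hδm hNm2 ht2g hguardF' t b.dir hW hα b hsrc rfl htgt
      rw [← hkc] at hcr
      exact hcr
  have hE : ‖((emlIterU m (unitsField (toUField (gaugeAct gw U))) b : (MatA N)ˣ) : MatA N) - 1‖ ≤ ((((F.P K).d - 1 : ℕ) : ℝ) * (crad (sideP (F.P K) Mc ρ) ρ : ℕ) *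
          ((1 + 2 * ((((F.P K).L : ℝ) ^ 2 + 6 * ((((F.P K).d + 2) * (F.P K).L : ℕ) : ℝ) ^ 2) * (4 * (((((F.P K).d - 1 : ℕ) : ℝ)) * ((2 * (F.P K).L - 1 : ℕ) : ℝ)) + 1))) * δ (m + 1)) +
        7 * ((((((F.P K).d + 2) * (F.P K).L : ℕ) : ℝ) ^ 2 / 4) * ((4 * (((((F.P K).d - 1 : ℕ) : ℝ)) * ((2 * (F.P K).L - 1 : ℕ) : ℝ)) + 1) * δ m)) +
        ((((F.P K).d + 1) * ((F.P K).L - 1) : ℕ) : ℝ) *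
          (kc * (((((F.P K).d - 1 : ℕ) : ℝ) * (((F.P K).L - 1 : ℕ) : ℝ)) * δ m))) := by
    rw [hdictb, val_unitsField]; exact hrow
  have hUr : ∀ b₀ : PBond (F.P K) 0, iterBlockOf m b₀.src ∈ ({y | y = b.src ∨ y = b.tgt} : Set (Site (F.P K) m)) →
      iterBlockOf m b₀.tgt ∈ ({y | y = b.src ∨ y = b.tgt} : Set (Site (F.P K) m)) →
      ‖((gaugeAct u U b₀ : SU N) : Matrix (Fin N) (Fin N) ℂ) - 1‖ ≤ 2 * ((F.P K).eta (m + 1) * (κ * ε' * ((F.P K).L : ℝ))) := by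
    intro b₀ hbs hbt
    have h := hreads b₀ hbs hbt
    rwa [val_unitsField] at h
  have hmK : m ≤ (F.P K).m + (F.P K).K := by omega
  have hφ := norm_accFrame_sub_shearRIter_le_record F K hmK ({y | y = b.src ∨ y = b.tgt} : Set (Site (F.P K) m)) (gaugeAct u U) hs00
    hbudget' hgd' hσF' hσS' hσ4' hUr V hV0 hVs m le_rfl
  have hVu := val_accFrame_mem_unitary ({y | y = b.src ∨ y = b.tgt} : Set (Site (F.P K) m)) hmK (gaugeAct u U) hs00 hbudget' hguard8 hUr V hV0 hVs m le_rfl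
  have hgs : ∀ x : Site (F.P K) 0, iterBlockOf m x = b.src → iterBlockOf m x ∈ ({y | y = b.src ∨ y = b.tgt} : Set (Site (F.P K) m)) :=
    fun x hx => Or.inl hx
  have hgt : ∀ x : Site (F.P K) 0, iterBlockOf m x = b.tgt → iterBlockOf m x ∈ ({y | y = b.src ∨ y = b.tgt} : Set (Site (F.P K) m)) :=
    fun x hx => Or.inr hx
  have hφle : 100 * (120 * ((((F.P K).d + 2) * (F.P K).L : ℕ) : ℝ) ^ 2 * ((F.P K).L : ℝ) ^ m * (2 * ((F.P K).eta (m + 1) * (κ * ε' * ((F.P K).L : ℝ))))) ^ 2 ≤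
      100 * (240 * ((((F.P K).d + 2) * (F.P K).L : ℕ) : ℝ) ^ 2 * (κ * ε' * ((F.P K).L : ℝ))) ^ 2 :=
    mul_le_mul_of_nonneg_left (pow_le_pow_left₀ hσm0 hσm 2) (by norm_num)
  have hφs := (hφ b.src hgs).trans hφle
  have hφt := (hφ b.tgt hgt).trans hφle
  obtain ⟨hidb, hρs, hρt⟩ := hid m b hb
  have hφ0 : (0 : ℝ) ≤ 100 * (240 * ((((F.P K).d + 2) * (F.P K).L : ℕ) : ℝ) ^ 2 * (κ * ε' * ((F.P K).L : ℝ))) ^ 2 := by positivity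
  have two : ∀ (a c : Matrix (Fin N) (Fin N) ℂ) {α β : ℝ}, ‖a - 1‖ ≤ α → ‖c - 1‖ ≤ β → 0 ≤ α → ‖a * c - 1‖ ≤ α + β + α * β := by
    intro a c α β ha hc hα
    have hid : a * c - 1 = (a - 1) * (c - 1) + (a - 1) + (c - 1) := by noncomm_ring
    have h1 : ‖(a - 1) * (c - 1)‖ ≤ α * β := (norm_mul_le _ _).trans (mul_le_mul ha hc (norm_nonneg _) hα)
    have h2 : ‖(a - 1) * (c - 1) + (a - 1) + (c - 1)‖ ≤ ‖(a - 1) * (c - 1)‖ + ‖a - 1‖ + ‖c - 1‖ :=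
      (norm_add_le _ _).trans (add_le_add (norm_add_le _ _) le_rfl)
    rw [hid]
    linarith
  have hx : ‖(((V m b.src)⁻¹ * toUT (shearRIter (avOfRecord F N K) (fun i => symCd F N K i) (loopAvgBlockOp expMeanLogSU) (gaugeAct u U) m) b.src *
        (toUT (gaugeAvgIter (loopAvgBlockOp expMeanLogSU) (fun x => blockLift (m + 1) h x * w x * (u x)⁻¹) m) b.src)⁻¹ : (Matrix (Fin N) (Fin N) ℂ)ˣ) :
          Matrix (Fin N) (Fin N) ℂ) - 1‖ ≤ 100 * (240 * ((((F.P K).d + 2) * (F.P K).L : ℕ) : ℝ) ^ 2 * (κ * ε' * ((F.P K).L : ℝ))) ^ 2 + 6 * ψ + 100 * (240 * ((((F.P K).d + 2) * (F.P K).L : ℕ) : ℝ) ^ 2 * (κ * ε' * ((F.P K).L : ℝ))) ^ 2 * (6 * ψ) := by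
    rw [Units.val_mul]
    refine two _ _ ?_ ?_ hφ0
    · rw [norm_inv_mul_toUT_sub_one_eq _ _ (hVu b.src hgs)]
      exact hφs
    · have h := norm_toUT_inv_mul_sub_one_eq
        (gaugeAvgIter (loopAvgBlockOp expMeanLogSU) (fun x => blockLift (m + 1) h x * w x * (u x)⁻¹) m) b.src (1 : (Matrix (Fin N) (Fin N) ℂ)ˣ)
      rw [mul_one, Units.val_one] at h
      rw [h, norm_sub_rev]; exact hρs
  have hz : ‖((toUT (gaugeAvgIter (loopAvgBlockOp expMeanLogSU) (fun x => blockLift (m + 1) h x * w x * (u x)⁻¹) m) b.tgt *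
        (toUT (shearRIter (avOfRecord F N K) (fun i => symCd F N K i) (loopAvgBlockOp expMeanLogSU) (gaugeAct u U) m) b.tgt)⁻¹ * V m b.tgt :
          (Matrix (Fin N) (Fin N) ℂ)ˣ) : Matrix (Fin N) (Fin N) ℂ) - 1‖ ≤ 100 * (240 * ((((F.P K).d + 2) * (F.P K).L : ℕ) : ℝ) ^ 2 * (κ * ε' * ((F.P K).L : ℝ))) ^ 2 + 6 * ψ + 100 * (240 * ((((F.P K).d + 2) * (F.P K).L : ℕ) : ℝ) ^ 2 * (κ * ε' * ((F.P K).L : ℝ))) ^ 2 * (6 * ψ) := by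
    rw [mul_assoc, Units.val_mul]
    have hb' : ‖((((toUT (shearRIter (avOfRecord F N K) (fun i => symCd F N K i) (loopAvgBlockOp expMeanLogSU) (gaugeAct u U) m) b.tgt)⁻¹ * V m b.tgt :
        (Matrix (Fin N) (Fin N) ℂ)ˣ)) : Matrix (Fin N) (Fin N) ℂ) - 1‖ ≤ 100 * (240 * ((((F.P K).d + 2) * (F.P K).L : ℕ) : ℝ) ^ 2 * (κ * ε' * ((F.P K).L : ℝ))) ^ 2 := by
      rw [norm_toUT_inv_mul_sub_one_eq]; exact hφt
    have h3 := two _ _ hρt hb' (by positivity)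
    refine h3.trans (le_of_eq ?_)
    ring
  rw [hidb, Units.val_mul, Units.val_mul]
  exact norm_conj3_sub_one_le hx hE hz

end Record

end Summit.QuantumFields.YangMills.BalabanUVNodes.N07SymNearRowsDentPhiB

end
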